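import Literature.NumberTheory.Automorphic.AutomorphicFormsGLTranslates
import Literature.NumberTheory.Automorphic.AutomorphicFormsKTranslates
import Literature.NumberTheory.Automorphic.AutomorphicRepsGLCuspidalL2Step4
import Literature.NumberTheory.Automorphic.ArchimedeanEnvelopingAction
import Literature.NumberTheory.Automorphic.ArchimedeanLieDerivKFinite
import HarnessLib

/-!
# Step 2 of Borel–Jacquet 4.6 for `GL_n`: the group part of the stability of `V_Π`, and the
reduction of `exists_cuspidalRepData_of_L2` to its Harish-Chandra inputs

Topic `NumberTheory/Automorphic`; sibling file of `AutomorphicRepsGLCuspidalL2` (namespace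
`Literature.NumberTheory.Automorphic`, sub-namespace `AutomorphicRepsGL` for the named facts). The
decomposition there records Step 2 of Borel–Jacquet 1979, 4.6 for `GL_n` as the named fact
`AutomorphicRepsGL.formsOfL2_isStableSubmodule hcpt μ`: for an irreducible closed invariant
`Π ≤ L²_cusp(GL_n(𝔸_K) ⧸ A_G GL_n(K), μ)`, the space `V_Π = formsOfL2 hcpt μ Π` spanned by the
automorphic forms `g ↦ f [g⁻¹]`, `[f] ∈ Π`, is a `(𝔤, K_∞) × GL_n(𝔸_K^∞)`-stable subspace of `𝒜`.
Here its *group* part is proved and the fact is reduced to its *Lie algebra* part: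

* the group half of Borel–Jacquet 1979, 4.3 for `GL_n` is in the tree: `K_∞`-translates
  (`isAutomorphicForm_rightTranslation_ofK_gl`, file `AutomorphicFormsKTranslates`) and
  `GL_n(𝔸_K^∞)`-translates (`IsAutomorphicForm.rightTranslation_gl`, file
  `AutomorphicFormsGLTranslates`) of automorphic forms are automorphic forms;
* `formsOfL2_le_comap_rightTranslation`, `formsOfL2_k_stable` — `V_Π` is stable under every right
  translation preserving automorphy whose action on classes preserves `Π`; in particular under
  `K_∞` (and under `GL_n(𝔸_K^∞)`, `formsOfL2_finite_stable`).
* `AutomorphicRepsGL.formsOfL2_lie_stable` (named fact, the residual analytic input of Step 2):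
  `V_Π` is stable under the Lie derivatives `φ ↦ X φ`, `X ∈ 𝔤𝔩_n(K_∞)` — in print: `X φ` is an
  automorphic form (Borel–Jacquet 1979, 4.3 (ii), whose moderate growth uses Harish-Chandra's
  convolution identity `φ = φ ∗ α`) and its class is the `L²`-derivative of `t ↦ Π(exp tX)[φ]`,
  which stays in the closed subspace `Π` (`[φ]` is a smooth vector).
* `AutomorphicRepsGL.formsOfL2_isStableSubmodule_of_lie` : `formsOfL2_lie_stable → formsOfL2_isStableSubmodule`,
  and the assembly `AutomorphicRepsGL.exists_cuspidalRepData_of_L2_of_HC` :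
  F1 (`formsOfL2_ne_bot`) → `formsOfL2_lie_stable` → F3 (`formsOfL2_irreducible`) →
  `exists_cuspidalRepData_of_L2 hcpt μ`, i.e. the target now rests exactly on the three
  Harish-Chandra-type inputs (density/automorphy of `K`-finite vectors, `𝔤`-stability,
  irreducibility of the Harish-Chandra module).

## The Lie algebra part, refined (Borel–Jacquet 4.3 (ii) and the `L²` side)

`formsOfL2_lie_stable` is in turn reduced to its two Harish-Chandra inputs, everything else being
proved. Of the `𝔤`-stability of `𝒜` (Borel–Jacquet 1979, 4.3 (ii); Bump 1997, §3.3, PDF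
pp. 292–296; Getz–Hahn 2024, (6.7), p. 118), smoothness (`IsArchSmooth.lieDeriv_gl`,
`ArchimedeanLieDerivSmooth`), `K_∞`-finiteness (`isKFinite_lieDeriv`, `ArchimedeanLieDerivKFinite`)
and `Z(𝔤)`-finiteness (`IsAutomorphicForm.zFinite_lieDeriv`, `ArchimedeanEnvelopingAction`: the
word action factors through `U(𝔤)` on smooth functions, `[X, Y] φ = X (Y φ) - Y (X φ)`, and `Z(𝔤)`
is central) of `X φ` are proved, and left invariance and the level are immediate
(`IsAutomorphicForm.lieDeriv_of` below); the tree's general-datum named facts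
`automorphicForms_isStableSubmodule 𝒟` / `mem_automorphicForms_iff 𝒟` (`AutomorphicForms`) are
not instantiated, since regularity of the `GL_n` datum is not yet proved and the generators of
`V_Π` must be certified automorphic pointwise. What remains is recorded as two named facts:

1. `AutomorphicRepsGL.hasModerateGrowth_lieDeriv hcpt` — **uniform moderate growth**: `X φ` has
   moderate growth for every automorphic form `φ` — Harish-Chandra's `φ = φ ∗ α`
   (`α ∈ C_c^∞(G_∞)`) for smooth `K`-finite `Z(𝔤)`-finite `φ`, whence `X φ = φ ∗ α'` and the
   height inequality (Harish-Chandra 1966, Thm. 1 = Borel 1972, Thm. 3.18 and Cor. 3.19;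
   Borel 1997, Thm. 2.14, Cor. 5.3, 5.6 (c): "`f` has uniform moderate growth"; Getz–Hahn 2024,
   Def. 6.4, p. 117);
2. `AutomorphicRepsGL.exists_toLp_mem_invQuot_eq_lieDeriv hcpt μ` — **the `L²` side** (BJ 4.6;
   Getz–Hahn Thm. 6.5.2, p. 121; Bump Thm. 3.3.4, PDF p. 296): if `φ = invQuot f` is an automorphic
   form with `[f]` in a closed invariant subspace `Π ≤ L²(μ)`, then `X φ = invQuot f_X` with
   `f_X ∈ ℒ²(μ)` and `[f_X] ∈ Π` (Borel 1972, Cor. 3.20–3.21: `K`-finite `Z(𝔤)`-finite vectors are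
   differentiable, again from `φ = φ ∗ α`).

Proved: `IsAutomorphicForm.lieDeriv_of` (1. → `X φ` automorphic), `formsOfL2_lie_stable_of`
(1. → 2. → `formsOfL2_lie_stable hcpt μ`, by span induction using additivity of `X` on smooth
functions), `AutomorphicRepsGL.formsOfL2_isStableSubmodule_of` (1. → 2. →
`formsOfL2_isStableSubmodule hcpt μ`). Both facts follow in print from Harish-Chandra's
convolution identity, which is attacked in sibling files (`HarishChandraConvolutionGL`).

## References

* A. Borel, H. Jacquet, *Automorphic forms and automorphic representations*, Proc. Sympos. Pure
  Math. 33 (Corvallis 1979), part 1, §4.3 and §4.6 [BorelJacquet1979].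
* Harish-Chandra, *Representations of a semisimple Lie group on a Banach space. I*, Trans. AMS 75
  (1953) [HarishChandra1953].
* Harish-Chandra, *Discrete series for semisimple Lie groups. II*, Acta Math. 116 (1966), Thm. 1
  [HarishChandra1966].
* A. Borel, *Représentations de groupes localement compacts*, LNM 276 (1972), Thm. 3.18,
  Cor. 3.19–3.21 [Borel1972].
* A. Borel, *Automorphic forms on `SL₂(ℝ)`*, Cambridge Tracts in Math. 130 (1997), Thm. 2.14,
  Cor. 5.3, 5.6 [Borel1997].
* D. Bump, *Automorphic Forms and Representations* (1997), §3.3, Thm. 3.3.4 (PDF pp. 292–296)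
  [Bump1997].
* J. R. Getz, H. Hahn, *An Introduction to Automorphic Representations* (2024), §6.3 (6.7), §6.5
  Thm. 6.5.2 (pp. 117–121) [GetzHahn2024].
-/

-- Mathlib idiom (Mathlib/Algebra/Lie/OfAssociative.lean); needed to mention Lie subalgebras of matrix algebras
attribute [local instance 100] LieRing.ofAssociativeRing

noncomputable section

open scoped MatrixGroups Classical
open NumberField NumberField.mixedEmbedding IsDedekindDomain
open _root_.MeasureTheory

namespace Literature.NumberTheory.Automorphic

variable {n : ℕ} {K : Type} [Field K] [NumberField K]
  {hcpt : isCompact_glFiniteIntegralLevel n K}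

/-! ### Stability of `V_Π` under automorphy-preserving right translations -/

section Invariant

variable {μ : Measure (AdelicGroupData.gl n K).automorphicQuotient}
  [SMulInvariantMeasure (AdelicGroupData.gl n K).Adelic
    (AdelicGroupData.gl n K).automorphicQuotient μ]

/-- **`V_Π` is stable under every right translation preserving automorphy.** For a closed
invariant subspace `Π ≤ L²` and `y ∈ GL_n(𝔸_K)` such that `r(y)` maps automorphic forms to
automorphic forms, `r(y)` maps `V_Π = formsOfL2 hcpt μ Π` into itself: on generators,
`r(y) (g ↦ f [g⁻¹]) = (g ↦ f' [g⁻¹])` with `f' = f (y⁻¹ • ·)` (`invQuot_smul`), whose class is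
`Π(y) [f] ∈ Π`. Borel–Jacquet 1979, 4.6. [cite: BorelJacquet1979, 4.6] -/
theorem formsOfL2_le_comap_rightTranslation
    (P : ContRepresentation.ClosedSubrep ((AdelicGroupData.gl n K).rightRegular μ))
    {y : (AdelicGroupData.gl n K).Adelic}
    (hy : ∀ φ : (AdelicGroupData.gl n K).Adelic → ℂ, IsAutomorphicForm (AutomorphyDatum.gl n K hcpt) φ →
      IsAutomorphicForm (AutomorphyDatum.gl n K hcpt) (rightTranslation (AdelicGroupData.gl n K) y φ)) :
    formsOfL2 hcpt μ P ≤ (formsOfL2 hcpt μ P).comap (rightTranslation (AdelicGroupData.gl n K) y) := by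
  refine Submodule.span_le.2 ?_
  rintro φ ⟨f, hf, hfP, rfl, hφ⟩
  rw [SetLike.mem_coe, Submodule.mem_comap, ← invQuot_smul]
  have hf' : MemLp (fun x => f (y⁻¹ • x)) 2 μ :=
    hf.comp_measurePreserving (measurePreserving_smul y⁻¹ μ)
  refine invQuot_mem_formsOfL2 hf' ?_ ?_
  · have key : (AdelicGroupData.gl n K).rightRegular μ y (hf.toLp f) = hf'.toLp _ := by
      rw [AdelicGroupData.rightRegular_apply, DomMulAct.mk_smul_toLp]
    rw [← key]
    exact P.apply_mem y hfP
  · rw [invQuot_smul]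
    exact hy _ hφ

/-- **`V_Π` is stable under right translation by `K_∞`** (the `k_stable` part of Step 2 of
Borel–Jacquet 4.6 for `GL_n`, unconditionally). [cite: BorelJacquet1979, 4.6] -/
theorem formsOfL2_k_stable
    (P : ContRepresentation.ClosedSubrep ((AdelicGroupData.gl n K).rightRegular μ))
    (k : (AutomorphyDatum.gl n K hcpt).arch.maximalCompact) :
    formsOfL2 hcpt μ P ≤ (formsOfL2 hcpt μ P).comap
      (rightTranslation (AdelicGroupData.gl n K) ((AutomorphyDatum.gl n K hcpt).ofK k)) :=
  formsOfL2_le_comap_rightTranslation P fun _ hφ => isAutomorphicForm_rightTranslation_ofK_gl hφ k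

end Invariant

/-! ### The residual Lie-algebra input and the assembly -/

section Automorphic

variable {μ : Measure (AdelicGroupData.gl n K).automorphicQuotient}
  [(AdelicGroupData.gl n K).IsAutomorphicMeasure μ]

variable (hcpt μ) in
/-- **Step 2, Lie algebra part (named fact).** For an irreducible closed invariant subspace
`Π ≤ L²_cusp(GL_n(𝔸_K) ⧸ A_G GL_n(K), μ)`, the space `V_Π` of automorphic forms `g ↦ f [g⁻¹]`,
`[f] ∈ Π`, is stable under the Lie derivatives `φ ↦ X φ`, `X ∈ 𝔤 = 𝔤𝔩_n(K_∞)` (right-invariant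
differentiation in the archimedean variable). In print: `X φ` is again an automorphic form
(Borel–Jacquet 1979, 4.3 (ii): the `𝔤`-stability of `𝒜`, whose moderate-growth step rests on
Harish-Chandra's convolution identity `φ = φ ∗ α`, `α ∈ C_c^∞(G_∞)`), and its class is the
`L²`-derivative at `t = 0` of `t ↦ Π(exp tX) [φ]`, which lies in the closed invariant subspace `Π`
(`[φ]` being a smooth vector of `Π`). This is the analytic residue of
`AutomorphicRepsGL.formsOfL2_isStableSubmodule` once its group part is proved
(`formsOfL2_isStableSubmodule_of_lie`). Borel–Jacquet 1979, 4.3 and 4.6. [cite: BorelJacquet1979, 4.3 and 4.6] -/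
def AutomorphicRepsGL.formsOfL2_lie_stable : Prop :=
  ∀ (P : CuspidalAutomorphicRepGL n K μ) (X : (AutomorphyDatum.gl n K hcpt).arch.lie),
    ∀ φ ∈ formsOfL2 hcpt μ P.1,
      lieDeriv (AutomorphyDatum.gl n K hcpt).ofArch X φ ∈ formsOfL2 hcpt μ P.1

/-- **Step 2 from its Lie algebra part**: `V_Π ≤ 𝒜` (by construction), `V_Π` is stable under
`GL_n(𝔸_K^∞)` (`formsOfL2_finite_stable`) and under `K_∞` (`formsOfL2_k_stable`), so the
`(𝔤, K_∞) × GL_n(𝔸_K^∞)`-stability of `V_Π` (`AutomorphicRepsGL.formsOfL2_isStableSubmodule`)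
reduces to its `𝔤`-stability (`AutomorphicRepsGL.formsOfL2_lie_stable`).
Borel–Jacquet 1979, 4.3 and 4.6. [cite: BorelJacquet1979, 4.6] -/
theorem AutomorphicRepsGL.formsOfL2_isStableSubmodule_of_lie
    (h : AutomorphicRepsGL.formsOfL2_lie_stable hcpt μ) :
    AutomorphicRepsGL.formsOfL2_isStableSubmodule hcpt μ := fun P =>
  { le_automorphicForms := formsOfL2_le_automorphicForms P.1
    finite_stable := fun _ hy => formsOfL2_finite_stable P.1 hy
    k_stable := fun k => formsOfL2_k_stable P.1 k
    lie_stable := h P }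

/-- **Borel–Jacquet 4.6 for `GL_n` from its Harish-Chandra inputs.** Every irreducible closed
invariant subspace of `L²_cusp(GL_n(𝔸_K) ⧸ A_G GL_n(K), μ)` comes from a cuspidal automorphic
representation datum (`AutomorphicRepsGL.exists_cuspidalRepData_of_L2 hcpt μ`), granted the three
analytic inputs: F1 `formsOfL2_ne_bot` (`Π` contains a non-zero automorphic form — density and
automorphy of the `K`-finite smooth vectors, Harish-Chandra's admissibility theorem),
`formsOfL2_lie_stable` (`𝔤`-stability of `V_Π`) and F3 `formsOfL2_irreducible` (irreducibility of
the Harish-Chandra module of an irreducible unitary representation). The group part of Step 2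
and Step 4 (automorphic forms in `L²_cusp` are cusp forms) are theorems
(`formsOfL2_isStableSubmodule_of_lie`, `isCuspFormGL_invQuot_of_mem_cuspidalSubspace_holds`).
Borel–Jacquet 1979, 4.6; Harish-Chandra 1953. [cite: BorelJacquet1979, 4.6] -/
theorem AutomorphicRepsGL.exists_cuspidalRepData_of_L2_of_HC
    (h₁ : AutomorphicRepsGL.formsOfL2_ne_bot hcpt μ)
    (h₂ : AutomorphicRepsGL.formsOfL2_lie_stable hcpt μ)
    (h₃ : AutomorphicRepsGL.formsOfL2_irreducible hcpt μ) :
    AutomorphicRepsGL.exists_cuspidalRepData_of_L2 hcpt μ :=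
  AutomorphicRepsGL.exists_cuspidalRepData_of_L2_of_three h₁
    (AutomorphicRepsGL.formsOfL2_isStableSubmodule_of_lie h₂) h₃

end Automorphic

/-! ## Borel–Jacquet 4.3 (ii) for `GL_n`, the `𝔤`-part: uniform moderate growth and the theorem -/

section Facts43

variable (hcpt) in
/-- **Lie derivatives of automorphic forms on `GL_n(𝔸_K)` have moderate growth** (a consequence
of the *uniform* moderate growth of automorphic forms, Borel 1997, 5.1 and 5.6 (c); Getz–Hahn 2024,
Def. 6.4; Borel–Jacquet 1979, 4.3 (ii); here one `X ∈ 𝔤` at a time, the constants may depend on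
`X`): if `φ` is an automorphic form on `GL_n(𝔸_K)` and `X ∈ 𝔤 = 𝔤𝔩_n(K_∞)`, the Lie derivative
`X φ` has moderate growth
(`HasModerateGrowth` for the height `adelicHeightGL` of the datum). In print: by Harish-Chandra's
lemma a smooth `K_∞`-finite `Z(𝔤)`-finite function satisfies `φ = φ ∗ α` for some
`α ∈ C_c^∞(G_∞)` (Harish-Chandra 1966, Thm. 1; Borel 1972, Thm. 3.18 and Cor. 3.19; Borel 1997,
Thm. 2.14), whence `X φ = φ ∗ α'` with `α'` a derivative of `α` (Borel 1997, Cor. 5.3 (1)) and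
`|X φ (g)| ≤ ‖α'‖₁ sup_{y ∈ supp α'} |φ (g y⁻¹)| ≤ C (1 ⊔ ‖g‖)^r` by the height inequality
`‖g y‖ ≤ c ‖g‖ ‖y‖` (BJ §1.2; `one_sup_adelicHeightGL_mul_le`). The deep input of Step 2
(Borel 1997, 5.6 (c) and Getz–Hahn 2024, Def. 6.4 / (6.7) are the proof pointers; the result for
general reductive `G`, in particular `GL_n`, is Borel–Jacquet 1979, 4.3 (ii)).
[cite: BorelJacquet1979, 4.3 (ii)] -/
def AutomorphicRepsGL.hasModerateGrowth_lieDeriv : Prop :=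
  ∀ φ : (AdelicGroupData.gl n K).Adelic → ℂ, IsAutomorphicForm (AutomorphyDatum.gl n K hcpt) φ →
    ∀ X : (AutomorphyDatum.gl n K hcpt).arch.lie,
      HasModerateGrowth (AutomorphyDatum.gl n K hcpt)
        (lieDeriv (AutomorphyDatum.gl n K hcpt).ofArch X φ)

/-- **`𝒜(GL_n)` is a `𝔤`-module** (Borel–Jacquet 1979, 4.3 (ii); Bump 1997, §3.3: "if `f` is
`K`-finite, then `X f` is defined and is also `K`-finite"; Getz–Hahn 2024, (6.7)), from fact 1:
for an automorphic form `φ` on `GL_n(𝔸_K)` and `X ∈ 𝔤 = 𝔤𝔩_n(K_∞)`, the Lie derivative `X φ` is an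
automorphic form. Left `GL_n(K)`-invariance is inherited pointwise; the level is kept because it
centralises `G_∞` (`lieDeriv_comp_mul_right`); `X φ` is smooth (`IsArchSmooth.lieDeriv_gl`),
`K_∞`-finite (`isKFinite_lieDeriv`, the `K_∞`-translates of `φ` being smooth by
`isArchSmooth_archTranslate`) and `Z(𝔤)`-finite (`IsAutomorphicForm.zFinite_lieDeriv`); moderate
growth is fact 1. [cite: BorelJacquet1979, 4.3 (ii)] -/
theorem IsAutomorphicForm.lieDeriv_of (h₁ : AutomorphicRepsGL.hasModerateGrowth_lieDeriv hcpt)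
    {φ : (AdelicGroupData.gl n K).Adelic → ℂ} (hφ : IsAutomorphicForm (AutomorphyDatum.gl n K hcpt) φ)
    (X : (AutomorphyDatum.gl n K hcpt).arch.lie) :
    IsAutomorphicForm (AutomorphyDatum.gl n K hcpt)
      (lieDeriv (AutomorphyDatum.gl n K hcpt).ofArch X φ) where
  leftInvariant γ hγ g := by
    have hleft : ∀ g', φ (γ * g') = φ g' := hφ.leftInvariant γ hγ
    simp only [lieDeriv, mul_assoc, hleft]
  exists_level := by
    obtain ⟨U, hU, hφU⟩ := hφ.exists_level
    refine ⟨U, hU, fun u hu g => ?_⟩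
    have hcomm : ∀ h : (AutomorphyDatum.gl n K hcpt).arch.carrier,
        (AutomorphyDatum.gl n K hcpt).ofArch h * u = u * (AutomorphyDatum.gl n K hcpt).ofArch h :=
      fun h => (AutomorphyDatum.gl n K hcpt).commute_ofArch h u
        ((AutomorphyDatum.gl n K hcpt).le_finiteAdelic U hU hu)
    have hfix : (fun g' => φ (g' * u)) = φ := funext fun g' => hφU u hu g'
    have key := lieDeriv_comp_mul_right (AutomorphyDatum.gl n K hcpt).ofArch X φ hcomm
    rw [hfix] at key
    exact (congrFun key g).symm
  archSmooth := hφ.archSmooth.lieDeriv_gl X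
  kFinite :=
    isKFinite_lieDeriv _ (fun k => isArchSmooth_archTranslate _ _ hφ.archSmooth) hφ.kFinite X
  zFinite := hφ.zFinite_lieDeriv X
  moderateGrowth := h₁ φ hφ X

end Facts43

/-! ## Borel–Jacquet 4.6 for `GL_n`: Lie derivatives stay in a closed invariant `Π ≤ L²` -/

section Fact46

variable {μ : Measure (AdelicGroupData.gl n K).automorphicQuotient}
  [(AdelicGroupData.gl n K).IsAutomorphicMeasure μ]

variable (hcpt μ) in
/-- **Lie derivatives of the automorphic forms of `Π` represent vectors of `Π`** (Borel–Jacquet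
1979, 4.6; Getz–Hahn 2024, Thm. 6.5.2; Bump 1997, Thm. 3.3.4): let `Π` be a closed
`GL_n(𝔸_K)`-invariant subspace of `L²(GL_n(𝔸_K) ⧸ A_G GL_n(K), μ)` and `f ∈ ℒ²(μ)` with `[f] ∈ Π`
such that `φ = invQuot f = (g ↦ f [g⁻¹])` is an automorphic form. Then for every
`X ∈ 𝔤 = 𝔤𝔩_n(K_∞)` there is `f_X ∈ ℒ²(μ)` with `[f_X] ∈ Π` and `invQuot f_X = X φ`: by
Harish-Chandra's lemma `φ = φ ∗ α` (Harish-Chandra 1966, Thm. 1; Borel 1972, Thm. 3.18), so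
`[f] = R(α̌) [f]` is a Gårding vector, hence a differentiable vector of the unitary one-parameter
group `t ↦ R(exp tX)` (Borel 1972, Cor. 3.20–3.21: `K`-finite `Z(𝔤)`-finite vectors are
differentiable); its `L²`-derivative `lim_{t → 0} (R(exp tX) [f] - [f]) / t` lies in the closed
invariant subspace `Π` and is represented (a.e., along an a.e.-convergent subsequence of difference
quotients) by the pointwise derivative, i.e. by the left-`A_G GL_n(K)`-invariant continuous
function `X φ` read on the quotient. The general (any closed invariant `Π`) scope is that of
Borel 1972, Cor. 3.19 and 3.21; Borel–Jacquet 1979, 4.6, Getz–Hahn Thm. 6.5.2 and Bump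
Thm. 3.3.4 print it for irreducible (cuspidal) `Π`.
[cite: Borel1972, Cor. 3.19 and 3.21] [cite: BorelJacquet1979, 4.6] -/
def AutomorphicRepsGL.exists_toLp_mem_invQuot_eq_lieDeriv : Prop :=
  ∀ (P : ContRepresentation.ClosedSubrep ((AdelicGroupData.gl n K).rightRegular μ))
    (f : (AdelicGroupData.gl n K).automorphicQuotient → ℂ) (hf : MemLp f 2 μ),
    hf.toLp f ∈ P →
      IsAutomorphicForm (AutomorphyDatum.gl n K hcpt) (invQuot (AdelicGroupData.gl n K) f) →
        ∀ X : (AutomorphyDatum.gl n K hcpt).arch.lie,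
          ∃ (f' : (AdelicGroupData.gl n K).automorphicQuotient → ℂ) (hf' : MemLp f' 2 μ),
            hf'.toLp f' ∈ P ∧
              invQuot (AdelicGroupData.gl n K) f' =
                lieDeriv (AutomorphyDatum.gl n K hcpt).ofArch X (invQuot (AdelicGroupData.gl n K) f)

end Fact46

/-! ## Discharge of the Lie algebra part from facts 1–2, and the assembly -/

section Assembly2

variable {μ : Measure (AdelicGroupData.gl n K).automorphicQuotient}
  [(AdelicGroupData.gl n K).IsAutomorphicMeasure μ]

/-- **`V_Π` is `𝔤`-stable, from facts 1–2** (discharge of `AutomorphicRepsGL.formsOfL2_lie_stable`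
from the two Harish-Chandra inputs). For every closed invariant `Π ≤ L²(μ)`, `X ∈ 𝔤` and
`φ ∈ V_Π`, `X φ ∈ V_Π`: on a generator `φ = invQuot f`, fact 2 writes `X φ = invQuot f_X` with
`[f_X] ∈ Π` and `IsAutomorphicForm.lieDeriv_of` (fact 1) says it is an automorphic form, so `X φ`
is again a generator; the general case follows by induction on the span, `X` being additive on
functions smooth in the archimedean variable (`IsArchSmooth.lieDeriv_add`; elements of `V_Π ≤ 𝒜`
are smooth) and homogeneous (`lieDeriv_smul`). Borel–Jacquet 1979, 4.3 (ii) and 4.6.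
[cite: BorelJacquet1979, 4.6] -/
theorem formsOfL2_lieDeriv_mem_of
    (h₁ : AutomorphicRepsGL.hasModerateGrowth_lieDeriv hcpt)
    (h₂ : AutomorphicRepsGL.exists_toLp_mem_invQuot_eq_lieDeriv hcpt μ)
    (P : ContRepresentation.ClosedSubrep ((AdelicGroupData.gl n K).rightRegular μ))
    (X : (AutomorphyDatum.gl n K hcpt).arch.lie)
    {φ : (AdelicGroupData.gl n K).Adelic → ℂ} (hφ : φ ∈ formsOfL2 hcpt μ P) :
    lieDeriv (AutomorphyDatum.gl n K hcpt).ofArch X φ ∈ formsOfL2 hcpt μ P := by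
  have hsmooth : ∀ ψ ∈ formsOfL2 hcpt μ P, IsArchSmooth (AutomorphyDatum.gl n K hcpt).ofArch ψ :=
    fun ψ hψ ↦ automorphicForms_le_archSmooth _ (formsOfL2_le_automorphicForms P hψ)
  induction hφ using Submodule.span_induction with
  | mem φ hgen =>
    obtain ⟨f, hf, hfP, rfl, hφ⟩ := hgen
    obtain ⟨f', hf', hf'P, hf'eq⟩ := h₂ P f hf hfP hφ X
    rw [← hf'eq]
    exact invQuot_mem_formsOfL2 hf' hf'P (hf'eq ▸ hφ.lieDeriv_of h₁ X)
  | zero => rw [lieDeriv_zero_right]; exact zero_mem _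
  | add ψ₁ ψ₂ hψ₁ hψ₂ ih₁ ih₂ =>
    rw [IsArchSmooth.lieDeriv_add _ X (hsmooth ψ₁ hψ₁) (hsmooth ψ₂ hψ₂)]
    exact add_mem ih₁ ih₂
  | smul c ψ _ ih => rw [lieDeriv_smul]; exact Submodule.smul_mem _ c ih

/-- **Discharge of the Lie algebra part of Step 2 from facts 1–2**:
`hasModerateGrowth_lieDeriv hcpt → exists_toLp_mem_invQuot_eq_lieDeriv hcpt μ →
formsOfL2_lie_stable hcpt μ`. Borel–Jacquet 1979, 4.3 (ii) and 4.6. [cite: BorelJacquet1979, 4.6] -/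
theorem AutomorphicRepsGL.formsOfL2_lie_stable_of
    (h₁ : AutomorphicRepsGL.hasModerateGrowth_lieDeriv hcpt)
    (h₂ : AutomorphicRepsGL.exists_toLp_mem_invQuot_eq_lieDeriv hcpt μ) :
    AutomorphicRepsGL.formsOfL2_lie_stable hcpt μ :=
  fun P X _ hφ => formsOfL2_lieDeriv_mem_of h₁ h₂ P.1 X hφ

/-- **Assembly of Step 2 (Borel–Jacquet 1979, 4.3 (ii) and 4.6).** Facts 1–2 give
`formsOfL2_isStableSubmodule hcpt μ`: for every irreducible closed invariant `Π ≤ L²_cusp`,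
`V_Π ≤ 𝒜` is stable under `GL_n(𝔸_K^∞)` (`formsOfL2_finite_stable`), `K_∞` (`formsOfL2_k_stable`)
and `𝔤` (`formsOfL2_lie_stable_of`). [cite: BorelJacquet1979, 4.6] -/
theorem AutomorphicRepsGL.formsOfL2_isStableSubmodule_of
    (h₁ : AutomorphicRepsGL.hasModerateGrowth_lieDeriv hcpt)
    (h₂ : AutomorphicRepsGL.exists_toLp_mem_invQuot_eq_lieDeriv hcpt μ) :
    AutomorphicRepsGL.formsOfL2_isStableSubmodule hcpt μ :=
  AutomorphicRepsGL.formsOfL2_isStableSubmodule_of_lie (AutomorphicRepsGL.formsOfL2_lie_stable_of h₁ h₂)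

/-- **Borel–Jacquet 4.6 for `GL_n` from F1, F3 and the two refined inputs of Step 2.**
[cite: BorelJacquet1979, 4.6] -/
theorem AutomorphicRepsGL.exists_cuspidalRepData_of_L2_of_HC'
    (h₁ : AutomorphicRepsGL.formsOfL2_ne_bot hcpt μ)
    (h₂ : AutomorphicRepsGL.hasModerateGrowth_lieDeriv hcpt)
    (h₂' : AutomorphicRepsGL.exists_toLp_mem_invQuot_eq_lieDeriv hcpt μ)
    (h₃ : AutomorphicRepsGL.formsOfL2_irreducible hcpt μ) :
    AutomorphicRepsGL.exists_cuspidalRepData_of_L2 hcpt μ :=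
  AutomorphicRepsGL.exists_cuspidalRepData_of_L2_of_HC h₁
    (AutomorphicRepsGL.formsOfL2_lie_stable_of h₂ h₂') h₃

end Assembly2

end Literature.NumberTheory.Automorphic
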